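import Literature.MathematicalPhysics.QuantumFieldTheory.Balaban1983to89.B9SectBE4H2GTransferQY
import Literature.MathematicalPhysics.QuantumFieldTheory.Balaban1983to89.B9SectBGFramesSelY

/-!
# `Balaban1983to89.B9SectBGFramesSelQY` — T. Bałaban, *Propagators for lattice gauge theories in a background field*, Commun. Math. Phys. **99** (1985)
# 389–434 [Balaban1985BackgroundPropagators], Thm 3.4 p. 400, Thm 3.3 p. 399, Sect. B pp. 400–407, (3.11)–(3.15) p. 393: THE G-SIDE SECT.-B FRAME
# CONSTRUCTORS AT A GENERIC AVERAGING PAIR `(𝔮, 𝔮s)` — `G[𝔮] := GAQY 𝔮 𝔮s par (GpY par)` (CASCADE-K piece «K2-G», stage C; the `(𝔮, 𝔮s)`-edition of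
# module S2 `B9SectBGFramesSelY`)

statement-level skeleton of published theorems with citation tags; proofs where landed; nothing here is a claim about the Yang–Mills mass gap

THE PRINT.  Theorem 3.3 (p. 399) and its Sect.-B step (pp. 404–407) are stated for `G(U) = Δ_a(U)⁻¹` (3.27) with the averaging operation `Q(U)` of
(3.11)–(3.13) — in print the operation of [Balaban1985Averaging] Prop. 2 p. 26 (the tree's knit letter `qKnitOfRecord`); the properties of `Q(U)` the
Sect.-B argument uses are its block-locality and size ((3.15) p. 393) and the variation bound (3.80)–(3.81) p. 406 under `U ↦ e^{iηA}U`.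

WHY THIS FILE (seat dag-n06-c gen 25; cell INBOX 2026-08-30 «⚑ K2-G SCOPE», stage C).  Module S2 builds the frames at the straight letter `GAY par parB
(GpY par) = GAQY (QY parB) (QsY parB) par (GpY par)`; the knit certificate's Sect.-B row (dag-n06-d «KA», `hBK`) is keyed to `GAQY qKnitOfRecord qsKnitOfRecord
parKnitY (GpY parKnitY)`.  THIS FILE is S2's constructor at a generic pair: `gFrame₅CodedOnSelQ` = `gFrame₅CodedOnSel` VERBATIM except (i) the letters are
`GbQC ∕ QbQC ∕ QsbQC ∕ F₂QC ∕ F₂sQC` of `B9SectBGWordDeltaAQY`, the field suppliers `reg_ginvQ_base ∕ gb_eq_cplxQ_pair ∕ readG342Q_base ∕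
crossReadQY_KACU ∕ writeG342_GbQC` of `B9SectBGReadCodedQY`; (ii) the three fields where S2 consumed a `QY`-specific ANALYTIC lemma — `hQb ∕ hQsb`
(`B9SectBQSizesY.hasMajorant_QbC ∕ hasMajorant_QsbC`, (3.15)) and `hF₂` (`B9SectBQVariationY.hasMajorant_F₂C ∕ F₂sC` from `VarParBY`, (3.80)) — are fed by
the DISPLAYED LAWS `hQ15` (constant `κQ`) and `hQ80` (constant `cF`) of exactly the fields' shapes at `G`-valued bases resp. (3.37) pairs of the coded class;
(iii) `hunitA` reads `deltaAQY _ (𝔮 j) (𝔮s j) (par j) (GpY _ (par j))`; the binders `hparB ∕ cVar ∕ hcVar ∕ hvarB` (read only by those lemmas) are GONE.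
Structure type, site family `KSC`, kernel `pullS (CinvY … par)` and every generic step theorem UNCHANGED; bond family `KACU … (GAQY _ (𝔮 j) (𝔮s j) (par j)
(GpY _ (par j))) (parB j) …`.

HONEST SCOPE.  Re-threading bookkeeping; every field is S2's proof term at the generic letters or a displayed law; nothing of [B9] asserted beyond S2's
displayed hypotheses plus the two size laws (now hypotheses instead of the `QY` lemmas); COUNT-NEUTRAL; N06 NOT discharged; one finite lattice programme —
nothing continuum ∕ OS ∕ mass-gap ∕ Clay.  Cell `pub-ymgap` (HUMAN RULING D-0062), Track A node N06 [B9], CASCADE-K (№383) piece K2-G.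

RELATED IN THE TREE, NOT DUPLICATED: `B9SectBGFramesSelY` (S2, the `QY` edition; its parents `gpFrame₂CodedOnSel ∕ cinvFrame₃CodedOnSel` of
`B9SectBFramesSelY` are USED), `B9SectBGWordDeltaAQY` ∕ `B9SectBGReadCodedQY` (stages A ∕ B1), `B9SectBParSelY` (the device) — USED BY NAME; no existing
module modified.
-/

noncomputable section

namespace Literature.MathematicalPhysics.QuantumFieldTheory.Balaban1983to89.B9SectBGFramesSelQY

open Literature.MathematicalPhysics.QuantumFieldTheory.Balaban1983to89.B9SectBParSelY
open Literature.MathematicalPhysics.QuantumFieldTheory.Balaban1983to89.B9SectBFramesSelY (gpFrame₂CodedOnSel cinvFrame₃CodedOnSel)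

variable {d ℓ : ℕ} {hd : 1 ≤ d + 1} {hL : Odd (ℓ + 1) ∧ 1 < ℓ + 1} {b₀ b₁ : ℝ} {Mstar : ℕ}
variable {𝔸 : Type} [NormedRing 𝔸] (P : B9SectBCodedClassR.RegExtraY d ℓ hd hL b₀ b₁ Mstar 𝔸) [NormedAlgebra ℂ 𝔸] [CompleteSpace 𝔸]

/-! ## GFrame — the root G frame at `G[𝔮]` -/

section GFrame


open Literature.MathematicalPhysics.QuantumFieldTheory.Balaban1983to89.B9SectBGFrameCodedYR hiding gFrame₅CodedOn stepEPos_KACU_frame_on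
open Literature.MathematicalPhysics.QuantumFieldTheory.Balaban1983to89.B9SectBCodedClassR (RegExtraY bg9YC)
open Literature.MathematicalPhysics.QuantumFieldTheory.Balaban1983to89.B9SectBGFrameCodedY hiding CrossReadY readG342_base crossReadY_KACU gFrame₅CodedOn stepEPos_KACU_frame_on
open Literature.MathematicalPhysics.QuantumFieldTheory.Balaban1983to89
open Literature.MathematicalPhysics.QuantumFieldTheory.Balaban1983to89.Node00 (SiteY BlkY FBondY IBondY CfgY SiteParY BondOpY BondParY UboxY shiftY GpY GAQY XY
  deltaAQY deltaPrimeAY bondCoordsY bondFunCoordsY)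
open Literature.MathematicalPhysics.QuantumFieldTheory.Balaban1983to89.B6Ineq2142KLevelV1 (β)
open Literature.MathematicalPhysics.QuantumFieldTheory.Balaban1983to89.B6KLevelCensusIndexV1 (KIdx kGeo)
open Literature.MathematicalPhysics.QuantumFieldTheory.Balaban1983to89.B6RandomWalk (HasMajorant hasMajorant_mono Ineq261)
open Literature.MathematicalPhysics.QuantumFieldTheory.Balaban1983to89.B9Thm34Ext (toB6)
open Literature.MathematicalPhysics.QuantumFieldTheory.Balaban1983to89.B9FromB6 (EBlock)
open Literature.MathematicalPhysics.QuantumFieldTheory.Balaban1983to89.B9GeoNormsKLevelV1 (geo9K geo9K_dist_nonneg)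
open Literature.MathematicalPhysics.QuantumFieldTheory.Balaban1983to89.B9Eq39Adjoint (covD covDstar prodCfg plaqU)
open Literature.MathematicalPhysics.QuantumFieldTheory.Balaban1983to89.B9Eq352DivFormLetters (conj)
open Literature.MathematicalPhysics.QuantumFieldTheory.Balaban1983to89.B9Eq352GradLetters (diffLetter)
open Literature.MathematicalPhysics.QuantumFieldTheory.Balaban1983to89.B9Eq371GradLetters (bT bU)
open Literature.MathematicalPhysics.QuantumFieldTheory.Balaban1983to89.B9Eq372RemLetters (lapDDLetter)
open Literature.MathematicalPhysics.QuantumFieldTheory.Balaban1983to89.B9Eq382V3Letters (dPrimeLetter)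
open Literature.MathematicalPhysics.QuantumFieldTheory.Balaban1983to89.B9Eq376POneLetters (conjHom gradLin divLin)
open Literature.MathematicalPhysics.QuantumFieldTheory.Balaban1983to89.B9Eq386Neumann (deltaA)
open Literature.MathematicalPhysics.QuantumFieldTheory.Balaban1983to89.B9Eq360DeltaPrimeAY (AfldY)
open Literature.MathematicalPhysics.QuantumFieldTheory.Balaban1983to89.B9PinMembersKLevelV1 (MemberY geo9Y bg9Y)
open Literature.MathematicalPhysics.QuantumFieldTheory.Balaban1983to89.B9SectBGpLettersY (decY decY_base decY_prod GVal blkC coordC expAC GopC norm_le_one_and_inv_of_mem)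
open Literature.MathematicalPhysics.QuantumFieldTheory.Balaban1983to89.B9SectBL2DictionaryY (coordC_base_eq)
open Literature.MathematicalPhysics.QuantumFieldTheory.Balaban1983to89.B9SectBKerLettersY (QcC QcsC CopC repY blkC_repY repY_injective)
open Literature.MathematicalPhysics.QuantumFieldTheory.Balaban1983to89.B9SectBGpFrameCodedYR (codingYx)
open Literature.MathematicalPhysics.QuantumFieldTheory.Balaban1983to89.B9SectBGpFrameCodedY (CplxLettersY)
open Literature.MathematicalPhysics.QuantumFieldTheory.Balaban1983to89.B9SectBKerFrameCodedYR (cinvFrame₃CodedOn CinvY)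
open Literature.MathematicalPhysics.QuantumFieldTheory.Balaban1983to89.B9SectBCodedCarrier (CCfg pullS)
open Literature.MathematicalPhysics.QuantumFieldTheory.Balaban1983to89.B9SectBCodedReadingsUR (KACU)
open Literature.MathematicalPhysics.QuantumFieldTheory.Balaban1983to89.B9SectBGpReadingsYR (KSC)
open Literature.MathematicalPhysics.QuantumFieldTheory.Balaban1983to89.B9SectBGpTransferInY (eBlock_mono)
open Literature.MathematicalPhysics.QuantumFieldTheory.Balaban1983to89.B9SectBStepWhole (StepEPos)
open Literature.MathematicalPhysics.QuantumFieldTheory.Balaban1983to89.B9SectBGFrameV5 (GFrame₅ stepEPos_of_gFrame₅)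
open Literature.MathematicalPhysics.QuantumFieldTheory.Balaban1983to89.B9SectBGWordDeltaAY (GbC QbC QsbC abC F₂C F₂sC LapBC word_mul_GbC GbC_eq_of_two_sided
  qbC_prod qsbC_prod)
open Literature.MathematicalPhysics.QuantumFieldTheory.Balaban1983to89.B9SectBGReadCodedYR (readG342_GbC_printed writeG342_GbC)
open Literature.MathematicalPhysics.QuantumFieldTheory.Balaban1983to89.B9SectBGReadCodedY (eta_inv_eq_abs_cf hasMajorant_of_eq GbC_eq_conj_bondOpCoordsRY hasMajorant_diffLetter_inr_mul hasMajorant_mul_diffLetter_inl)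
open Literature.MathematicalPhysics.QuantumFieldTheory.Balaban1983to89.B9RWSumsReadsNbr (nbr)
open Literature.MathematicalPhysics.QuantumFieldTheory.Balaban1983to89.B9SectBGReadYR (eBlock_kernelFamilyB_of_KACU_base)
open Literature.MathematicalPhysics.QuantumFieldTheory.Balaban1983to89.Node00.OpsYRead342CrossB (hasMajorant_conj_cdsB_O_of_eBlockB hasMajorant_conj_O_cdB_of_eBlockB)
open Literature.MathematicalPhysics.QuantumFieldTheory.Balaban1983to89.B9SectBGClassLettersY (stencilFB_blkC stencilSt_blkC stencilLoc_blkC Reg335PlaqY CplxLettersGY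
  VarParBY)
open Literature.MathematicalPhysics.QuantumFieldTheory.Balaban1983to89.B9GeoLemma21KLevelV1 (geo9K_one_le_L)
open Literature.MathematicalPhysics.QuantumFieldTheory.Balaban1983to89.B9Thm31SiteCurvatureCommutatorsY (shiftY_shiftY_comm)
open Literature.MathematicalPhysics.QuantumFieldTheory.Balaban1983to89.B9SectBQSizesY (hasMajorant_QbC hasMajorant_QsbC hasMajorant_abC)
open Literature.MathematicalPhysics.QuantumFieldTheory.Balaban1983to89.B9SectBQVariationY (hasMajorant_F₂C hasMajorant_F₂sC)

open Literature.MathematicalPhysics.QuantumFieldTheory.Balaban1983to89.B9SectBGWordDeltaAQY (GbQC QbQC QsbQC F₂QC F₂sQC word_mul_GbQC GbQC_eq_of_two_sided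
  qbQC_prod qsbQC_prod)
open Literature.MathematicalPhysics.QuantumFieldTheory.Balaban1983to89.B9SectBGReadCodedQY (readG342_GbQC_printed writeG342_GbQC CrossReadQY readG342Q_base crossReadQY_KACU
  reg_ginvQ_base gb_eq_cplxQ_pair)

variable [NormOneClass 𝔸] [FiniteDimensional ℝ 𝔸] {J : Type} (f : J → MemberY d ℓ hd hL b₀ b₁ Mstar)
  [∀ x : MemberY d ℓ hd hL b₀ b₁ Mstar, Fintype (geo9Y x).Site]
  [instDS : ∀ x : MemberY d ℓ hd hL b₀ b₁ Mstar, DecidableEq (geo9Y x).Site] [instNE : ∀ x : MemberY d ℓ hd hL b₀ b₁ Mstar, Nonempty (geo9Y x).Site]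
  (c35 : ℝ) (G : Subgroup 𝔸ˣ)
  (𝔮 : ∀ j : J, CfgY 𝔸 (f j).toKIdx → ((FBondY (f j).toKIdx → 𝔸) →ₗ[ℂ] (IBondY (f j).toKIdx → 𝔸)))
  (𝔮s : ∀ j : J, CfgY 𝔸 (f j).toKIdx → ((IBondY (f j).toKIdx → 𝔸) →ₗ[ℂ] (FBondY (f j).toKIdx → 𝔸)))
  (par : ∀ j : J, SiteParY 𝔸 (f j).toKIdx) (parB : ∀ j : J, BondParY 𝔸 (f j).toKIdx)
  {ι : Type} [Fintype ι] [DecidableEq ι] (b : Module.Basis ι ℝ 𝔸) (ιB : ∀ j : J, BlkY (f j).toKIdx → IBondY (f j).toKIdx)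
  (C37 C38 : ∀ j : J, ℝ → CfgY 𝔸 (f j).toKIdx → AfldY 𝔸 (f j).toKIdx → Prop)

set_option maxHeartbeats 400000 in
/-- ★★★ **THE G FRAME `GFrame₅` OVER THE CODED CARRIERS OF A SUBFAMILY AT A GENERIC AVERAGING PAIR `(𝔮, 𝔮s)`** (`G[𝔮] := GAQY 𝔮 𝔮s par (GpY par)`; the
(3.15) ∕ (3.80) size laws of the pair DISPLAYED as `hQ15 ∕ hQ80`; otherwise S2's `gFrame₅CodedOnSel` verbatim) — `B9SectBGFrameCodedYRG.gFrame₅CodedOn` on the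
parent `cinvFrame₃CodedOnSel`, the G letter `GbQC` read at the selected transporter `parSelC G _ (par j) c`; displayed laws `hparG ∕ hparC ∕ hunitG ∕ hunitXG`
(guarded by (3.35) above the thresholds, resp. by the coded class (3.37)) in place of `hpar ∕ hunit ∕ hunitX`; all other binders, constants and fields as in RG1.
[cite: Balaban1985BackgroundPropagators, Thm 3.4 p.400, Thm 3.3 p.399, (3.15) p.393, (3.24)–(3.27) pp.394–395, (3.35)–(3.37) p.396, (3.42) p.397, (3.80)–(3.86) pp.406–407, Thm 3.11 p.416; Balaban1984PropagatorsII, (2.51) p.232] -/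
noncomputable def gFrame₅CodedOnSelQ (hι : ∀ (j : J) (s : BlkY (f j).toKIdx), β (f j).toKIdx.hN (f j).toKIdx.D (f j).toKIdx.hk (ιB j s) = s)
    (hG1 : ∀ u : 𝔸ˣ, u ∈ G → ‖(u : 𝔸)‖ ≤ 1)
    (M₂ : ℝ) (hM₂ : 0 ≤ M₂) (hrepr : ∀ (v : 𝔸) (j : ι), |b.repr v j| ≤ M₂ * ‖v‖) (hcR : 0 < M₂ * ∑ j, ‖b j‖)
    (Cq : ℝ) (hCq : 0 ≤ Cq) (hC37 : ∀ j β' U a, C37 j β' U a → GVal G (f j).toKIdx U ∧ CplxLettersY G (f j) (par j) (ιB j) Cq β' U a)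
    (MInv aInv aW : ℝ) (hMInv : 0 < MInv) (haInv : 0 < aInv) (haW : 0 < aW)
    (hparG : ∀ j (α₀ : ℝ) (U : CfgY 𝔸 (f j).toKIdx), MInv ≤ (geo9Y (f j)).M → 0 < α₀ → (geo9Y (f j)).M * α₀ ≤ aInv →
      (bg9YC 𝔸 G P (f j)).Reg335 c35 α₀ U → ∀ z w, par j U z w ∈ G)
    (hparC : ∀ j β' U a, C37 j β' U a → ∀ z w, par j U z w ∈ G)
    (hunitG : ∀ j (α₀ : ℝ) (U : CfgY 𝔸 (f j).toKIdx), MInv ≤ (geo9Y (f j)).M → 0 < α₀ → (geo9Y (f j)).M * α₀ ≤ aInv →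
      (bg9YC 𝔸 G P (f j)).Reg335 c35 α₀ U → IsUnit (deltaPrimeAY (f j).toKIdx (par j) U))
    (hunitXG : ∀ j (α₀ : ℝ) (U : CfgY 𝔸 (f j).toKIdx), MInv ≤ (geo9Y (f j)).M → 0 < α₀ → (geo9Y (f j)).M * α₀ ≤ aInv →
      (bg9YC 𝔸 G P (f j)).Reg335 c35 α₀ U → IsUnit (XY (f j).toKIdx (par j) (GpY (f j).toKIdx (par j)) U))
    (hsym : ∀ j (U : CfgY 𝔸 (f j).toKIdx) (z w : SiteY (f j).toKIdx), par j U z w = (par j U w z)⁻¹)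
    -- the G-side displayed laws
    (hunitA : ∀ j (α₀ : ℝ) (U : CfgY 𝔸 (f j).toKIdx), MInv ≤ (geo9Y (f j)).M → 0 < α₀ → (geo9Y (f j)).M * α₀ ≤ aInv →
      (bg9YC 𝔸 G P (f j)).Reg335 c35 α₀ U → IsUnit (deltaAQY (f j).toKIdx (𝔮 j) (𝔮s j) (par j) (GpY (f j).toKIdx (par j)) U))
    (hb₁ : 0 ≤ b₁)
    (C₀ : ℝ) (hC₀ : 0 ≤ C₀)
    (hreg335P : ∀ j (α₀ : ℝ) (U : CfgY 𝔸 (f j).toKIdx), MInv ≤ (geo9Y (f j)).M → 0 < α₀ → (geo9Y (f j)).M * α₀ ≤ aInv →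
      (bg9YC 𝔸 G P (f j)).Reg335 c35 α₀ U → Reg335PlaqY G (f j) (ιB j) C₀ U)
    (hC37G : ∀ j β' U a, C37 j β' U a → CplxLettersGY G (f j) (ιB j) β' U a)
    -- [K2-G] the DISPLAYED LAWS of the averaging pair `(𝔮, 𝔮s)` (at `QY parB`: `B9SectBQSizesY.hasMajorant_QbC ∕ QsbC`, `B9SectBQVariationY.hasMajorant_F₂C ∕ F₂sC`)
    (κQ : ℝ) (hκQ : 0 ≤ κQ)
    (hQ15 : ∀ j (α₀ : ℝ) (U : CfgY 𝔸 (f j).toKIdx) (δ : ℝ), MInv ≤ (geo9Y (f j)).M → 0 < α₀ → (geo9Y (f j)).M * α₀ ≤ aInv →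
      (bg9YC 𝔸 G P (f j)).Reg335 c35 α₀ U → 0 < δ → δ ≤ 1 →
      HasMajorant (g := toB6 (geo9Y (f j)) 0 True) (fun q : (Fin (d + 1) × SiteY (f j).toKIdx) × ι => blkC (f j).toKIdx (ιB j) q.1.2)
          (QbQC (f j).toKIdx (𝔮 j) b (.base U)) (fun a a' => κQ * Real.exp (-(δ * (geo9Y (f j)).dist a a'))) ∧
        HasMajorant (g := toB6 (geo9Y (f j)) 0 True) (fun q : (Fin (d + 1) × SiteY (f j).toKIdx) × ι => blkC (f j).toKIdx (ιB j) q.1.2)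
          (QsbQC (f j).toKIdx (𝔮s j) b (.base U)) (fun a a' => κQ * Real.exp (-(δ * (geo9Y (f j)).dist a a'))))
    (cF : ℝ) (hcF : 0 ≤ cF)
    (hQ80 : ∀ j (β' : ℝ) (U : CfgY 𝔸 (f j).toKIdx) (a : AfldY 𝔸 (f j).toKIdx), 0 < β' → C37 j β' U a → ∀ δ : ℝ, 0 < δ → δ ≤ 1 →
      HasMajorant (g := toB6 (geo9Y (f j)) 0 True) (fun q : (Fin (d + 1) × SiteY (f j).toKIdx) × ι => blkC (f j).toKIdx (ιB j) q.1.2)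
          (F₂QC (f j).toKIdx (𝔮 j) b (.base U) (.mult a)) (fun a₁ a₂ => cF * β' * Real.exp (-(δ * (geo9Y (f j)).dist a₁ a₂))) ∧
        HasMajorant (g := toB6 (geo9Y (f j)) 0 True) (fun q : (Fin (d + 1) × SiteY (f j).toKIdx) × ι => blkC (f j).toKIdx (ιB j) q.1.2)
          (F₂sQC (f j).toKIdx (𝔮s j) b (.base U) (.mult a)) (fun a₁ a₂ => cF * β' * Real.exp (-(δ * (geo9Y (f j)).dist a₁ a₂))))
    (hMd : 2 * ((d : ℝ) + 1) < MInv) (mN : ℕ) (hnbr : ∀ (j : J) (y' : IBondY (f j).toKIdx), (nbr (geo9Y (f j)) (2 * ((d : ℝ) + 1)) y').card ≤ mN) :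
    GFrame₅ c35 (fun j => geo9Y (f j)) (fun j => (codingYx P G (f j) (C37 j) (C38 j)).bg) (fun j => KSC P G (f j) (par j) (C37 j) (C38 j)) b (Fin (d + 1))
      (fun j => SiteY (f j).toKIdx) (fun j => BlkY (f j).toKIdx × ι)
      (fun j => KACU P G (f j) (GAQY (f j).toKIdx (𝔮 j) (𝔮s j) (par j) (GpY (f j).toKIdx (par j))) (parB j) (C37 j) (C38 j))
      (fun j => pullS (codingYx P G (f j) (C37 j) (C38 j)) (CinvY P f G par j)) :=
  { cinvFrame₃CodedOnSel P f c35 G par b ιB C37 C38 hι hG1 M₂ hM₂ hrepr hcR Cq hCq hC37 MInv aInv aW hMInv haInv haW hparG hparC hunitG hunitXG hsym with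
    C₀ := C₀
    κQb := κQ
    cFb := cF
    abar := (M₂ * ∑ j, ‖b j‖) * b₁
    cRG := fun δ => M₂ * (∑ j, ‖b j‖) + cXY (d := d) (ℓ := ℓ) b M₂ mN δ
    wBG := fun B _ => (M₂ * ∑ j, ‖b j‖) * B + 1
    wδG := fun δ => δ
    C₀_nonneg := hC₀
    κQb_nonneg := hκQ
    cFb_nonneg := hcF
    abar_nonneg := mul_nonneg hcR.le hb₁
    cRG_pos := fun δ hδ => add_pos_of_pos_of_nonneg hcR (cXY_nonneg (d := d) (ℓ := ℓ) b hM₂ mN δ)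
    wBG_pos := fun B _ hB _ => by positivity
    wδG_pos := fun δ hδ => hδ
    rep := fun j => repY (f j).toKIdx ι
    Gb := fun j c => GbQC (f j).toKIdx (𝔮 j) (𝔮s j) (parSelC G (f j).toKIdx (par j) c) b c
    Qb := fun j c => QbQC (f j).toKIdx (𝔮 j) b c
    Qsb := fun j c => QsbQC (f j).toKIdx (𝔮s j) b c
    ab := fun j => abC (f j).toKIdx b
    F₂ := fun j c c' => F₂QC (f j).toKIdx (𝔮 j) b c c'
    F₂s := fun j c c' => F₂sQC (f j).toKIdx (𝔮s j) b c c'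
    LapB := fun j c => LapBC (f j).toKIdx b c
    L_one_le := fun j => geo9K_one_le_L (f j).toKIdx
    T_comm := fun j μ ν z => shiftY_shiftY_comm (f j).toKIdx μ ν z
    hrep := fun j q => blkC_repY (f j).toKIdx ι (ιB j) q
    hinj := fun j => repY_injective (f j).toKIdx ι
    stencilFB := fun j μ ν z => stencilFB_blkC (f j).toKIdx (ιB j) (hι j) μ ν z
    stencilSt := fun j μ z q hq => stencilSt_blkC (f j).toKIdx (ιB j) (hι j) μ z q hq
    stencilLoc := fun j μ z q hq => stencilLoc_blkC (f j).toKIdx (ιB j) (hι j) μ z q hq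
    reg335 := fun j α₀ c hM hα₀ hMa hreg => by
      obtain ⟨U, rfl, hU⟩ := (codingYx P G (f j) (C37 j) (C38 j)).exists_of_bg_Reg335 hreg
      exact hreg335P j α₀ U hM hα₀ hMa hU
    hQb := fun j α₀ c δ hM hα₀ hMa hreg hδ hδ1 => by
      obtain ⟨U, rfl, hU⟩ := (codingYx P G (f j) (C37 j) (C38 j)).exists_of_bg_Reg335 hreg
      exact (hQ15 j α₀ U δ hM hα₀ hMa hU hδ hδ1).1
    hQsb := fun j α₀ c δ hM hα₀ hMa hreg hδ hδ1 => by
      obtain ⟨U, rfl, hU⟩ := (codingYx P G (f j) (C37 j) (C38 j)).exists_of_bg_Reg335 hreg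
      exact (hQ15 j α₀ U δ hM hα₀ hMa hU hδ hδ1).2
    ha324 := fun j => by
      letI : Fintype (geo9K (f j).toKIdx).Site := ‹∀ x : MemberY d ℓ hd hL b₀ b₁ Mstar, Fintype (geo9Y x).Site› (f j)
      refine hasMajorant_mono _ (hasMajorant_abC (Rr := 0) (Hp := True) (f j).toKIdx b (ιB j) (hι j) hM₂ hrepr hb₁) fun a a' => ?_
      split_ifs <;> first | exact le_of_eq (mul_assoc _ _ _).symm | exact le_of_eq (mul_zero _) | simp_all
    reg_ginv := fun j α₀ c hM hα₀ hMa hreg => by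
      obtain ⟨U, rfl, hU⟩ := (codingYx P G (f j) (C37 j) (C38 j)).exists_of_bg_Reg335 hreg
      have hR : InRegY G (f j).toKIdx (par j) U := ⟨hU.1.1, hparG j α₀ U hM hα₀ hMa hU⟩
      dsimp only [cinvFrame₃CodedOnSel, gpFrame₂CodedOnSel]
      erw [parSelC_base_of_inRegY G (f j).toKIdx (par j) hR]
      exact reg_ginvQ_base G (f j) (𝔮 j) (𝔮s j) (par j) b U hU.1.1 (hunitA j α₀ U hM hα₀ hMa hU)
    gb_eq_cplx := fun j α₁ c c' X hα₁ h37 h1 h2 => by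
      obtain ⟨U, a, rfl, rfl, hC⟩ := (codingYx P G (f j) (C37 j) (C38 j)).exists_of_bg_Cplx337 h37
      exact (gb_eq_cplxQ_pair G (f j) (𝔮 j) (𝔮s j) (selY G (f j).toKIdx (par j) U) b U (hC37 j α₁ U a hC).1 a X h1 h2).2
    qb_mul := fun j α₁ c c' hα₁ h37 => by
      obtain ⟨U, a, rfl, rfl, hC⟩ := (codingYx P G (f j) (C37 j) (C38 j)).exists_of_bg_Cplx337 h37
      exact ⟨qbQC_prod (f j).toKIdx (𝔮 j) b U a, qsbQC_prod (f j).toKIdx (𝔮s j) b U a⟩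
    hF₂ := fun j α₁ c c' hα₁ h37 δ hδ hδ1 => by
      obtain ⟨U, a, rfl, rfl, hC⟩ := (codingYx P G (f j) (C37 j) (C38 j)).exists_of_bg_Cplx337 h37
      exact hQ80 j α₁ U a hα₁ hC δ hδ hδ1
    cplxG := fun j α₁ c c' hα₁ h37 => by
      obtain ⟨U, a, rfl, rfl, hC⟩ := (codingYx P G (f j) (C37 j) (C38 j)).exists_of_bg_Cplx337 h37
      exact hC37G j α₁ U a hC
    readG342 := fun j α₀ c B₀ δ hM hα₀ hMa hreg hB₀ hδ hE => by
      obtain ⟨U, rfl, hU⟩ := (codingYx P G (f j) (C37 j) (C38 j)).exists_of_bg_Reg335 hreg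
      have hR : InRegY G (f j).toKIdx (par j) U := ⟨hU.1.1, hparG j α₀ U hM hα₀ hMa hU⟩
      dsimp only [cinvFrame₃CodedOnSel, gpFrame₂CodedOnSel]
      erw [parSelC_base_of_inRegY G (f j).toKIdx (par j) hR]
      exact readG342Q_base P G (f j) (𝔮 j) (𝔮s j) (par j) (parB j) b (ιB j) (C37 j) (C38 j) (hι j) hM₂ hrepr (fun δ _ => cXY_nonneg (d := d) (ℓ := ℓ) b hM₂ mN δ)
        (crossReadQY_KACU P G (f j) (𝔮 j) (𝔮s j) (par j) (parB j) b (ιB j) (C37 j) (C38 j) (hι j) hG1 hM₂ hrepr (hnbr j)) (lt_of_lt_of_le hMd hM) U hU.1.1 hB₀ hδ hE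
    writeG342 := fun j c c' α₁ B δ hα₁ hα₁W h37 hB hδ h0 h1 h2 h3 => by
      obtain ⟨U, a, rfl, rfl, hC⟩ := (codingYx P G (f j) (C37 j) (C38 j)).exists_of_bg_Cplx337 h37
      have hR : InRegY G (f j).toKIdx (par j) U := ⟨(hC37 j α₁ U a hC).1, hparC j α₁ U a hC⟩
      dsimp only [cinvFrame₃CodedOnSel, gpFrame₂CodedOnSel] at h0 h1 h2 h3
      erw [parSelC_prod_of_inRegY G (f j).toKIdx (par j) hR] at h0 h1 h2 h3
      have hw := writeG342_GbQC P (Rr := 0) (Hp := True) G (f j) (𝔮 j) (𝔮s j) (par j) (parB j) b (ιB j) (C37 j) (C38 j) (hι j) hM₂ hrepr U (hC37 j α₁ U a hC).1 a hB h0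
        (fun ν => h1 (Sum.inl ν)) (fun ν => h2 (Sum.inr ν)) h3
      exact eBlock_mono (f j).toKIdx _ (by linarith) hw }

end GFrame

/-! ## H1G — the (3.43) bond-sector frame at `G[𝔮]` -/

section H1G


open Literature.MathematicalPhysics.QuantumFieldTheory.Balaban1983to89.B9SectBH1GFrameCodedYR hiding h1GFrame₆CodedOn stepH1Pos_KACU_frame_on
open Literature.MathematicalPhysics.QuantumFieldTheory.Balaban1983to89.B9SectBCodedClassR (RegExtraY bg9YC)
open Literature.MathematicalPhysics.QuantumFieldTheory.Balaban1983to89.B9SectBH1GFrameCodedY hiding h1G_transfer_KACU h1GFrame₆CodedOn stepH1Pos_KACU_frame_on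
open LatticeFieldCalculus (supDist)
open B9Eq39Adjoint (R R_smul R_zero R_sub R_add)
open B6GlobalChartV1 (PV blkV1 boxEquiv)
open B6Geom246MultiLevelTorus (geomT)
open B6Ineq2142KLevelV1 (β beta_level)
open B6KLevelCensusIndexV1 (KIdx Adm kGeo)
open B6RandomWalk (HasMajorant hasMajorant_mono BlockSupp Ineq261)
open B9Thm34Ext (toB6)
open B9FromB6 (EBlock H1Block)
open B9GeoNormsKLevelV1 (geo9K geo9K_dist_nonneg)
open B9GeoLemma21KLevelV1 (geo9Y_dist_comm geo9Y_dist_triangle geo9Y_len_pos one_le_k)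
open B9Eq310Hermitian (norm_R_le)
open B9Eq352DivFormLetters (conj coordEquiv conj_mul)
open B9Eq352GradLetters (diffLetter)
open B9Eq371GradLetters (bT bU)
open B9CoReadingCoords (cdBₗ cdsBₗ cdBₗ_apply cdsBₗ_apply)
open B9PinMembersKLevelV1 (MemberY geo9Y bg9Y)
open B9Eq360DeltaPrimeAY (AfldY)
open B9SectBGpLettersY (GVal decY decY_base blkC coordC norm_le_one_and_inv_of_mem)
open B9SectBL2DictionaryY (coordC_base_eq)
open B9SectBGpFrameCodedYR (codingYx)
open B9SectBGpFrameCodedY (CplxLettersY)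
open B9SectBGpReadingsYR (KSC)
open B9SectBGpReadingsY (baseY)
open B9SectBCodedCarrier (CCfg pullS)
open B9SectBCodedReadingsUR (KACU)
open B9SectBKerFrameCodedYR (CinvY)
open B9SectBStepWhole (StepPos StepH1Pos)
open B9RWSumsReadsNbr (nbr mem_nbr)
open B9RWSumsCompleteGeo9YNbr (len_le_of_dist_lt_M_geo9K)
open B9GeoNormsKLevelModelSignsV1 (modelSignsOn_geo9K)
open Node00 (SiteY BlkY FBondY IBondY CfgY BallY SiteParY BondParY BondOpY liftY liftY_apply holderQB cdB cdsB UboxY shiftY GAQY GpY XY deltaAQY deltaPrimeAY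
  bondCoordsY bondFunCoordsY)
open B9SectBGWordDeltaAY (bondOpCoordsRY GbC)
open B9SectBGReadCodedY (eta_inv_eq_abs_cf hasMajorant_of_eq hasMajorant_conj_bondOpCoordsRY GbC_eq_conj_bondOpCoordsRY bondOpCoordsRY_mul)
open B9SectBGReadYR (readG342Y_KACU)
open B9SectBGFrameCodedYRG (gFrame₅CodedOn)
open B9SectBGFrameCodedY (cXY cXY_nonneg parB_contractive)
open B9SectBGClassLettersY (Reg335PlaqY CplxLettersGY VarParBY)
open B9SectBH1GFrameV6 (H1GFrame₆ stepH1Pos_of_h1GFrame₆)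
open B9SectBH1GReadWriteYR (KACU_h1_inr_eq KACU_h1_off)
open B9SectBH1GReadWriteY (probeB norm_probeB norm_probeB_neg h1ReadB h1ReadB_le_of_probes probeB_apply)
open B9SectBH1GProbesY (lamB lamB_GbC lamB_DL_GbC lamB_GbC_DR lamB_GbC_DF lamB_conj_bondOpCoordsRY lamB_coordEquiv_bondFunCoordsY norm_map_symm_mul_diffLetter_inr
  norm_map_symm_mul_diffLetter_inl probeBC probeBC_symm blockSupp_coordEquiv_bondFun_liftY probeL_lamB_le probeR_lamB_le norm_lamB_le_of_hasMajorant
  probe_crossB_lamB_le)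
open B9SectBH1GUndiffY (HolderLipBY lenB lenB_pos probeB_undiff_le cutH_inr_nonneg)

open Literature.MathematicalPhysics.QuantumFieldTheory.Balaban1983to89.B9SectBGWordDeltaAQY (GbQC QbQC QsbQC F₂QC F₂sQC)
open Literature.MathematicalPhysics.QuantumFieldTheory.Balaban1983to89.B9SectBGReadCodedQY (GbQC_eq_conj_bondOpCoordsRY)
open Literature.MathematicalPhysics.QuantumFieldTheory.Balaban1983to89.B9SectBH1GTransferQY (lamB_GbQC lamB_DL_GbQC lamB_GbQC_DR lamB_GbQC_DF h1G_transfer_KACUQ)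
open Literature.MathematicalPhysics.QuantumFieldTheory.Balaban1983to89.B9SectBE4H2GTransferQY (lamB_DL_GbQC_DR lamB_L_GbQC_DR e4h2G_transfer_KACUQ)

variable [NormOneClass 𝔸] [FiniteDimensional ℝ 𝔸] {J : Type} (f : J → MemberY d ℓ hd hL b₀ b₁ Mstar)
  [∀ x : MemberY d ℓ hd hL b₀ b₁ Mstar, Fintype (geo9Y x).Site]
  [instDS : ∀ x : MemberY d ℓ hd hL b₀ b₁ Mstar, DecidableEq (geo9Y x).Site] [instNE : ∀ x : MemberY d ℓ hd hL b₀ b₁ Mstar, Nonempty (geo9Y x).Site]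
  (c35 : ℝ) (G : Subgroup 𝔸ˣ)
  (𝔮 : ∀ j : J, CfgY 𝔸 (f j).toKIdx → ((FBondY (f j).toKIdx → 𝔸) →ₗ[ℂ] (IBondY (f j).toKIdx → 𝔸)))
  (𝔮s : ∀ j : J, CfgY 𝔸 (f j).toKIdx → ((IBondY (f j).toKIdx → 𝔸) →ₗ[ℂ] (FBondY (f j).toKIdx → 𝔸)))
  (par : ∀ j : J, SiteParY 𝔸 (f j).toKIdx) (parB : ∀ j : J, BondParY 𝔸 (f j).toKIdx)
  {ι : Type} [Fintype ι] [DecidableEq ι] (b : Module.Basis ι ℝ 𝔸) (ιB : ∀ j : J, BlkY (f j).toKIdx → IBondY (f j).toKIdx)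
  (C37 C38 : ∀ j : J, ℝ → CfgY 𝔸 (f j).toKIdx → AfldY 𝔸 (f j).toKIdx → Prop)

set_option maxHeartbeats 400000 in
/-- ★★★ **THE (3.43) BOND-SECTOR FRAME `H1GFrame₆` OVER THE CODED CARRIERS OF A SUBFAMILY, AT A GENERIC AVERAGING PAIR `(𝔮, 𝔮s)`** (S2's constructor verbatim on `gFrame₅CodedOnSelQ`, transfer `h1G_transfer_KACUQ`) —
`B9SectBH1GFrameCodedYRG.h1GFrame₆CodedOn` on `gFrame₅CodedOnSel`; the transfer `h1G_transfer_KACU` at the base of a (3.37) pair, where the selected transporter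
IS `par` (`hparC`). [cite: Balaban1985BackgroundPropagators, Thm 3.4 p.400, Thm 3.3 p.399, (3.43) p.398, p.403 l.1–9, (3.82)–(3.86) p.407, (3.35)–(3.37) p.396; Balaban1984PropagatorsII, Lemma 2.1 p.234, (2.51)–(2.52) p.232] -/
noncomputable def h1GFrame₆CodedOnSelQ (hι : ∀ (j : J) (s : BlkY (f j).toKIdx), β (f j).toKIdx.hN (f j).toKIdx.D (f j).toKIdx.hk (ιB j s) = s)
    (hG1 : ∀ u : 𝔸ˣ, u ∈ G → ‖(u : 𝔸)‖ ≤ 1)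
    (M₂ : ℝ) (hM₂ : 0 ≤ M₂) (hrepr : ∀ (v : 𝔸) (j : ι), |b.repr v j| ≤ M₂ * ‖v‖) (hcR : 0 < M₂ * ∑ j, ‖b j‖)
    (Cq : ℝ) (hCq : 0 ≤ Cq) (hC37 : ∀ j β' U a, C37 j β' U a → GVal G (f j).toKIdx U ∧ CplxLettersY G (f j) (par j) (ιB j) Cq β' U a)
    (MInv aInv aW : ℝ) (hMInv : 0 < MInv) (haInv : 0 < aInv) (haW : 0 < aW)
    (hparG : ∀ j (α₀ : ℝ) (U : CfgY 𝔸 (f j).toKIdx), MInv ≤ (geo9Y (f j)).M → 0 < α₀ → (geo9Y (f j)).M * α₀ ≤ aInv →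
      (bg9YC 𝔸 G P (f j)).Reg335 c35 α₀ U → ∀ z w, par j U z w ∈ G)
    (hparC : ∀ j β' U a, C37 j β' U a → ∀ z w, par j U z w ∈ G)
    (hunitG : ∀ j (α₀ : ℝ) (U : CfgY 𝔸 (f j).toKIdx), MInv ≤ (geo9Y (f j)).M → 0 < α₀ → (geo9Y (f j)).M * α₀ ≤ aInv →
      (bg9YC 𝔸 G P (f j)).Reg335 c35 α₀ U → IsUnit (deltaPrimeAY (f j).toKIdx (par j) U))
    (hunitXG : ∀ j (α₀ : ℝ) (U : CfgY 𝔸 (f j).toKIdx), MInv ≤ (geo9Y (f j)).M → 0 < α₀ → (geo9Y (f j)).M * α₀ ≤ aInv →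
      (bg9YC 𝔸 G P (f j)).Reg335 c35 α₀ U → IsUnit (XY (f j).toKIdx (par j) (GpY (f j).toKIdx (par j)) U))
    (hsym : ∀ j (U : CfgY 𝔸 (f j).toKIdx) (z w : SiteY (f j).toKIdx), par j U z w = (par j U w z)⁻¹)
    (hunitA : ∀ j (α₀ : ℝ) (U : CfgY 𝔸 (f j).toKIdx), MInv ≤ (geo9Y (f j)).M → 0 < α₀ → (geo9Y (f j)).M * α₀ ≤ aInv →
      (bg9YC 𝔸 G P (f j)).Reg335 c35 α₀ U → IsUnit (deltaAQY (f j).toKIdx (𝔮 j) (𝔮s j) (par j) (GpY (f j).toKIdx (par j)) U))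
    (hparB : ∀ j (U : CfgY 𝔸 (f j).toKIdx), GVal G (f j).toKIdx U → ∀ y f', parB j U y f' ∈ G) (hb₁ : 0 ≤ b₁)
    (C₀ : ℝ) (hC₀ : 0 ≤ C₀)
    (hreg335P : ∀ j (α₀ : ℝ) (U : CfgY 𝔸 (f j).toKIdx), MInv ≤ (geo9Y (f j)).M → 0 < α₀ → (geo9Y (f j)).M * α₀ ≤ aInv →
      (bg9YC 𝔸 G P (f j)).Reg335 c35 α₀ U → Reg335PlaqY G (f j) (ιB j) C₀ U)
    (hC37G : ∀ j β' U a, C37 j β' U a → CplxLettersGY G (f j) (ιB j) β' U a)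
    -- [K2-G] the DISPLAYED LAWS of the averaging pair `(𝔮, 𝔮s)` (at `QY parB`: `B9SectBQSizesY.hasMajorant_QbC ∕ QsbC`, `B9SectBQVariationY.hasMajorant_F₂C ∕ F₂sC`)
    (κQ : ℝ) (hκQ : 0 ≤ κQ)
    (hQ15 : ∀ j (α₀ : ℝ) (U : CfgY 𝔸 (f j).toKIdx) (δ : ℝ), MInv ≤ (geo9Y (f j)).M → 0 < α₀ → (geo9Y (f j)).M * α₀ ≤ aInv →
      (bg9YC 𝔸 G P (f j)).Reg335 c35 α₀ U → 0 < δ → δ ≤ 1 →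
      HasMajorant (g := toB6 (geo9Y (f j)) 0 True) (fun q : (Fin (d + 1) × SiteY (f j).toKIdx) × ι => blkC (f j).toKIdx (ιB j) q.1.2)
          (QbQC (f j).toKIdx (𝔮 j) b (.base U)) (fun a a' => κQ * Real.exp (-(δ * (geo9Y (f j)).dist a a'))) ∧
        HasMajorant (g := toB6 (geo9Y (f j)) 0 True) (fun q : (Fin (d + 1) × SiteY (f j).toKIdx) × ι => blkC (f j).toKIdx (ιB j) q.1.2)
          (QsbQC (f j).toKIdx (𝔮s j) b (.base U)) (fun a a' => κQ * Real.exp (-(δ * (geo9Y (f j)).dist a a'))))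
    (cF : ℝ) (hcF : 0 ≤ cF)
    (hQ80 : ∀ j (β' : ℝ) (U : CfgY 𝔸 (f j).toKIdx) (a : AfldY 𝔸 (f j).toKIdx), 0 < β' → C37 j β' U a → ∀ δ : ℝ, 0 < δ → δ ≤ 1 →
      HasMajorant (g := toB6 (geo9Y (f j)) 0 True) (fun q : (Fin (d + 1) × SiteY (f j).toKIdx) × ι => blkC (f j).toKIdx (ιB j) q.1.2)
          (F₂QC (f j).toKIdx (𝔮 j) b (.base U) (.mult a)) (fun a₁ a₂ => cF * β' * Real.exp (-(δ * (geo9Y (f j)).dist a₁ a₂))) ∧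
        HasMajorant (g := toB6 (geo9Y (f j)) 0 True) (fun q : (Fin (d + 1) × SiteY (f j).toKIdx) × ι => blkC (f j).toKIdx (ιB j) q.1.2)
          (F₂sQC (f j).toKIdx (𝔮s j) b (.base U) (.mult a)) (fun a₁ a₂ => cF * β' * Real.exp (-(δ * (geo9Y (f j)).dist a₁ a₂))))
    (hMd : 2 * ((d : ℝ) + 1) < MInv) (mN : ℕ) (hnbr : ∀ (j : J) (y' : IBondY (f j).toKIdx), (nbr (geo9Y (f j)) (2 * ((d : ℝ) + 1)) y').card ≤ mN)
    {cLip rL : ℝ} (hcLip : 0 ≤ cLip) (hrL : 0 ≤ rL)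
    (hLipB : ∀ (j : J) (α₀ : ℝ) (U : CfgY 𝔸 (f j).toKIdx), (bg9YC 𝔸 G P (f j)).Reg335 c35 α₀ U → HolderLipBY (f j).toKIdx cLip rL (parB j U) U)
    (hMr : rL + 1 < MInv) :
    H1GFrame₆ c35 (fun j => geo9Y (f j)) (fun j => (codingYx P G (f j) (C37 j) (C38 j)).bg) (fun j => KSC P G (f j) (par j) (C37 j) (C38 j)) b (Fin (d + 1))
      (fun j => SiteY (f j).toKIdx) (fun j => BlkY (f j).toKIdx × ι)
      (fun j => KACU P G (f j) (GAQY (f j).toKIdx (𝔮 j) (𝔮s j) (par j) (GpY (f j).toKIdx (par j))) (parB j) (C37 j) (C38 j))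
      (fun j => pullS (codingYx P G (f j) (C37 j) (C38 j)) (CinvY P f G par j)) :=
  { gFrame₅CodedOnSelQ P f c35 G 𝔮 𝔮s par parB b ιB C37 C38 hι hG1 M₂ hM₂ hrepr hcR Cq hCq hC37 MInv aInv aW hMInv haInv haW hparG hparC hunitG hunitXG hsym hunitA
      hb₁ C₀ hC₀ hreg335P hC37G κQ hκQ hQ15 cF hcF hQ80 hMd mN hnbr with
    wHG := fun B₀ B δc Bβ => wHG6 (2 * ((d : ℝ) + 1)) (((ℓ + 1 : ℕ) : ℝ)) (∑ j, ‖b j‖) M₂ (M₂ * ∑ j, ‖b j‖) cLip rL mN B₀ B δc Bβ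
    wHGδ := fun δc => δc / 6
    wHGδ_pos := fun δc hδc => by positivity
    h1G_transfer := fun j α₀ c c' α₁ B₀ B δ δc Bβ hM hα₀ hMa hreg hα₁ haW' h37 hB₀ hB hδ hδc hδcδ hE hH1 HL HR => by
      obtain ⟨U, a, rfl, rfl, hC⟩ := (codingYx P G (f j) (C37 j) (C38 j)).exists_of_bg_Cplx337 h37
      have hR : InRegY G (f j).toKIdx (par j) U := ⟨(hC37 j α₁ U a hC).1, hparC j α₁ U a hC⟩
      dsimp only [gFrame₅CodedOnSelQ, cinvFrame₃CodedOnSel, gpFrame₂CodedOnSel] at HL HR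
      erw [parSelC_base_of_inRegY G (f j).toKIdx (par j) hR] at HL HR
      exact h1G_transfer_KACUQ P c35 G (f j) (𝔮 j) (𝔮s j) (par j) (parB j) b (ιB j) (C37 j) (C38 j) (hι j) hG1 (hparB j) hM₂ hrepr hcLip hrL (hLipB j)
        (fun _ => hnbr j) hMr (fun δ' => M₂ * (∑ j, ‖b j‖) + cXY (d := d) (ℓ := ℓ) b M₂ mN δ') α₀ (.base U) (.mult a) α₁ B₀ B δ δc Bβ hM hα₀ hMa hreg hα₁
        haW' h37 hB₀ hB hδ hδc hδcδ (le_add_of_nonneg_right (cXY_nonneg (d := d) (ℓ := ℓ) b hM₂ mN δ)) hE hH1 HL HR }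

end H1G

/-! ## E4H2G — the (3.44)∕(3.45) bond-sector frame at `G[𝔮]` -/

section E4H2G


open Literature.MathematicalPhysics.QuantumFieldTheory.Balaban1983to89.B9SectBE4H2GFrameCodedYR hiding e4h2GFrame₆CodedOn stepE4Pos_KACU_frame_on stepH2Pos_KACU_frame_on
open Literature.MathematicalPhysics.QuantumFieldTheory.Balaban1983to89.B9SectBCodedClassR (RegExtraY bg9YC)
open Literature.MathematicalPhysics.QuantumFieldTheory.Balaban1983to89.B9SectBE4H2GFrameCodedY hiding e4h2G_transfer_KACU e4h2GFrame₆CodedOn stepE4Pos_KACU_frame_on stepH2Pos_KACU_frame_on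
open LatticeFieldCalculus (supDist)
open B9Eq39Adjoint (R R_smul R_zero R_sub R_add)
open B6GlobalChartV1 (PV blkV1 boxEquiv)
open B6Geom246MultiLevelTorus (geomT)
open B6Ineq2142KLevelV1 (β beta_level)
open B6KLevelCensusIndexV1 (KIdx Adm kGeo)
open B6RandomWalk (HasMajorant hasMajorant_mono BlockSupp Ineq261)
open B9Thm34Ext (toB6)
open B9FromB6 (EBlock H1Block E4Block H2Block)
open B9GeoNormsKLevelV1 (geo9K geo9K_dist_nonneg geo9K_holder_mono_bond)
open B9GeoLemma21KLevelV1 (geo9Y_dist_comm geo9Y_dist_triangle geo9Y_len_pos one_le_k)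
open B9Eq310Hermitian (norm_R_le)
open B9Eq352DivFormLetters (conj coordEquiv conj_neg norm_coordSymm_apply_le)
open B9Eq352GradLetters (diffLetter)
open B9Eq371GradLetters (bT bU)
open B9CoReadingCoords (cdBₗ cdsBₗ cdBₗ_apply cdsBₗ_apply)
open B9BackgroundsKLevelV1 (shiftsV1)
open B9PinMembersKLevelV1 (MemberY geo9Y bg9Y)
open B9Eq360DeltaPrimeAY (AfldY)
open B9SectBGpLettersY (GVal decY decY_base blkC coordC norm_le_one_and_inv_of_mem)
open B9SectBL2DictionaryY (coordC_base_eq)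
open B9SectBGpFrameCodedYR (codingYx)
open B9SectBGpFrameCodedY (CplxLettersY)
open B9SectBGpReadingsYR (KSC)
open B9SectBGpReadingsY (baseY)
open B9SectBCodedCarrier (CCfg pullS)
open B9SectBCodedReadingsUR (KACU)
open B9SectBKerFrameCodedYR (CinvY)
open B9SectBStepWhole (StepPos StepE4Pos StepH2Pos StepPos.mono)
open B9RWSumsReadsNbr (nbr mem_nbr)
open B9GeoNormsKLevelModelSignsV1 (modelSignsOn_geo9K)
open Node00 (SiteY BlkY FBondY IBondY CfgY BallY SiteParY BondParY BondOpY liftY liftY_apply holderQB cdB cdsB UboxY shiftY GAQY GpY XY deltaAQY deltaPrimeAY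
  bondCoordsY bondFunCoordsY)
open Node00.OpsYRead342CrossB (norm_cdsB_le_norm_cdB_unshift dist_blkV1_unshift_le)
open B9SectBGWordDeltaAY (bondOpCoordsRY GbC)
open B9SectBGReadCodedY (eta_inv_eq_abs_cf hasMajorant_of_eq hasMajorant_conj_bondOpCoordsRY GbC_eq_conj_bondOpCoordsRY bondOpCoordsRY_mul bondOpCoordsRY_cdBₗ bondOpCoordsRY_cdsBₗ diffLetter_abs_eq)
open B9SectBGReadYR (readG342Y_KACU)
open B9SectBGFrameCodedYRG (gFrame₅CodedOn)
open B9SectBGFrameCodedY (cXY cXY_nonneg parB_contractive)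
open B9SectBGClassLettersY (Reg335PlaqY CplxLettersGY VarParBY)
open B9SectBE4H2GFrameV6 (E4H2GFrame₆ stepE4H2Pos_of_e4h2GFrame₆)
open B9SectBH1GReadWriteYR (KACU_h1_inr_eq)
open B9SectBH1GReadWriteY (probeB norm_probeB h1ReadB)
open B9SectBH1GProbesY (lamB lamB_apply' lamB_GbC lamB_DL_GbC lamB_GbC_DR lamB_conj_bondOpCoordsRY lamB_coordEquiv_bondFunCoordsY probeBC probeBC_symm
  blockSupp_coordEquiv_bondFun_liftY probeL_lamB_le blkC_snd_eq_blkV1 blkC_bondCoordsY_snd)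
open B9SectBH1GUndiffY (HolderLipBY cutH_inr_nonneg)
open B9SectBE4H2GReadWriteYR (KACU_e4_inr_eq KACU_e4_inl KACU_h2_inr_eq KACU_h2_off)
open B9SectBE4H2GReadWriteY (e4ReadB h2ReadB norm_le_e4ReadB probe_le_h2ReadB e4ReadB_le_of_forall h2ReadB_le_of_probes)

open Literature.MathematicalPhysics.QuantumFieldTheory.Balaban1983to89.B9SectBGWordDeltaAQY (GbQC QbQC QsbQC F₂QC F₂sQC)
open Literature.MathematicalPhysics.QuantumFieldTheory.Balaban1983to89.B9SectBGReadCodedQY (GbQC_eq_conj_bondOpCoordsRY)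
open Literature.MathematicalPhysics.QuantumFieldTheory.Balaban1983to89.B9SectBH1GTransferQY (lamB_GbQC lamB_DL_GbQC lamB_GbQC_DR lamB_GbQC_DF h1G_transfer_KACUQ)
open Literature.MathematicalPhysics.QuantumFieldTheory.Balaban1983to89.B9SectBE4H2GTransferQY (lamB_DL_GbQC_DR lamB_L_GbQC_DR e4h2G_transfer_KACUQ)

variable [NormOneClass 𝔸] [FiniteDimensional ℝ 𝔸] {J : Type} (f : J → MemberY d ℓ hd hL b₀ b₁ Mstar)
  [∀ x : MemberY d ℓ hd hL b₀ b₁ Mstar, Fintype (geo9Y x).Site]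
  [instDS : ∀ x : MemberY d ℓ hd hL b₀ b₁ Mstar, DecidableEq (geo9Y x).Site] [instNE : ∀ x : MemberY d ℓ hd hL b₀ b₁ Mstar, Nonempty (geo9Y x).Site]
  (c35 : ℝ) (G : Subgroup 𝔸ˣ)
  (𝔮 : ∀ j : J, CfgY 𝔸 (f j).toKIdx → ((FBondY (f j).toKIdx → 𝔸) →ₗ[ℂ] (IBondY (f j).toKIdx → 𝔸)))
  (𝔮s : ∀ j : J, CfgY 𝔸 (f j).toKIdx → ((IBondY (f j).toKIdx → 𝔸) →ₗ[ℂ] (FBondY (f j).toKIdx → 𝔸)))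
  (par : ∀ j : J, SiteParY 𝔸 (f j).toKIdx) (parB : ∀ j : J, BondParY 𝔸 (f j).toKIdx)
  {ι : Type} [Fintype ι] [DecidableEq ι] (b : Module.Basis ι ℝ 𝔸) (ιB : ∀ j : J, BlkY (f j).toKIdx → IBondY (f j).toKIdx)
  (C37 C38 : ∀ j : J, ℝ → CfgY 𝔸 (f j).toKIdx → AfldY 𝔸 (f j).toKIdx → Prop)

set_option maxHeartbeats 400000 in
/-- ★★★ **THE (3.44) ∕ (3.45) BOND-SECTOR FRAME `E4H2GFrame₆` OVER THE CODED CARRIERS OF A SUBFAMILY, AT A GENERIC AVERAGING PAIR `(𝔮, 𝔮s)`** (S2's constructor verbatim on `gFrame₅CodedOnSelQ`, transfer `e4h2G_transfer_KACUQ`) —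
`B9SectBE4H2GFrameCodedYRG.e4h2GFrame₆CodedOn` on `gFrame₅CodedOnSel`; the transfer `e4h2G_transfer_KACU` at the base of a (3.37) pair, where the selected
transporter IS `par` (`hparC`). [cite: Balaban1985BackgroundPropagators, Thm 3.4 p.400, Thm 3.3 p.399, (3.44)–(3.45) p.398, p.403 l.2–5, (3.82)–(3.86) p.407, (3.35)–(3.37) p.396; Balaban1984PropagatorsII, Lemma 2.1 p.234, (2.51)–(2.52) p.232] -/
noncomputable def e4h2GFrame₆CodedOnSelQ (hι : ∀ (j : J) (s : BlkY (f j).toKIdx), β (f j).toKIdx.hN (f j).toKIdx.D (f j).toKIdx.hk (ιB j s) = s)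
    (hG1 : ∀ u : 𝔸ˣ, u ∈ G → ‖(u : 𝔸)‖ ≤ 1)
    (M₂ : ℝ) (hM₂ : 0 ≤ M₂) (hrepr : ∀ (v : 𝔸) (j : ι), |b.repr v j| ≤ M₂ * ‖v‖) (hcR : 0 < M₂ * ∑ j, ‖b j‖)
    (Cq : ℝ) (hCq : 0 ≤ Cq) (hC37 : ∀ j β' U a, C37 j β' U a → GVal G (f j).toKIdx U ∧ CplxLettersY G (f j) (par j) (ιB j) Cq β' U a)
    (MInv aInv aW : ℝ) (hMInv : 0 < MInv) (haInv : 0 < aInv) (haW : 0 < aW)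
    (hparG : ∀ j (α₀ : ℝ) (U : CfgY 𝔸 (f j).toKIdx), MInv ≤ (geo9Y (f j)).M → 0 < α₀ → (geo9Y (f j)).M * α₀ ≤ aInv →
      (bg9YC 𝔸 G P (f j)).Reg335 c35 α₀ U → ∀ z w, par j U z w ∈ G)
    (hparC : ∀ j β' U a, C37 j β' U a → ∀ z w, par j U z w ∈ G)
    (hunitG : ∀ j (α₀ : ℝ) (U : CfgY 𝔸 (f j).toKIdx), MInv ≤ (geo9Y (f j)).M → 0 < α₀ → (geo9Y (f j)).M * α₀ ≤ aInv →
      (bg9YC 𝔸 G P (f j)).Reg335 c35 α₀ U → IsUnit (deltaPrimeAY (f j).toKIdx (par j) U))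
    (hunitXG : ∀ j (α₀ : ℝ) (U : CfgY 𝔸 (f j).toKIdx), MInv ≤ (geo9Y (f j)).M → 0 < α₀ → (geo9Y (f j)).M * α₀ ≤ aInv →
      (bg9YC 𝔸 G P (f j)).Reg335 c35 α₀ U → IsUnit (XY (f j).toKIdx (par j) (GpY (f j).toKIdx (par j)) U))
    (hsym : ∀ j (U : CfgY 𝔸 (f j).toKIdx) (z w : SiteY (f j).toKIdx), par j U z w = (par j U w z)⁻¹)
    (hunitA : ∀ j (α₀ : ℝ) (U : CfgY 𝔸 (f j).toKIdx), MInv ≤ (geo9Y (f j)).M → 0 < α₀ → (geo9Y (f j)).M * α₀ ≤ aInv →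
      (bg9YC 𝔸 G P (f j)).Reg335 c35 α₀ U → IsUnit (deltaAQY (f j).toKIdx (𝔮 j) (𝔮s j) (par j) (GpY (f j).toKIdx (par j)) U))
    (hb₁ : 0 ≤ b₁)
    (C₀ : ℝ) (hC₀ : 0 ≤ C₀)
    (hreg335P : ∀ j (α₀ : ℝ) (U : CfgY 𝔸 (f j).toKIdx), MInv ≤ (geo9Y (f j)).M → 0 < α₀ → (geo9Y (f j)).M * α₀ ≤ aInv →
      (bg9YC 𝔸 G P (f j)).Reg335 c35 α₀ U → Reg335PlaqY G (f j) (ιB j) C₀ U)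
    (hC37G : ∀ j β' U a, C37 j β' U a → CplxLettersGY G (f j) (ιB j) β' U a)
    -- [K2-G] the DISPLAYED LAWS of the averaging pair `(𝔮, 𝔮s)` (at `QY parB`: `B9SectBQSizesY.hasMajorant_QbC ∕ QsbC`, `B9SectBQVariationY.hasMajorant_F₂C ∕ F₂sC`)
    (κQ : ℝ) (hκQ : 0 ≤ κQ)
    (hQ15 : ∀ j (α₀ : ℝ) (U : CfgY 𝔸 (f j).toKIdx) (δ : ℝ), MInv ≤ (geo9Y (f j)).M → 0 < α₀ → (geo9Y (f j)).M * α₀ ≤ aInv →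
      (bg9YC 𝔸 G P (f j)).Reg335 c35 α₀ U → 0 < δ → δ ≤ 1 →
      HasMajorant (g := toB6 (geo9Y (f j)) 0 True) (fun q : (Fin (d + 1) × SiteY (f j).toKIdx) × ι => blkC (f j).toKIdx (ιB j) q.1.2)
          (QbQC (f j).toKIdx (𝔮 j) b (.base U)) (fun a a' => κQ * Real.exp (-(δ * (geo9Y (f j)).dist a a'))) ∧
        HasMajorant (g := toB6 (geo9Y (f j)) 0 True) (fun q : (Fin (d + 1) × SiteY (f j).toKIdx) × ι => blkC (f j).toKIdx (ιB j) q.1.2)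
          (QsbQC (f j).toKIdx (𝔮s j) b (.base U)) (fun a a' => κQ * Real.exp (-(δ * (geo9Y (f j)).dist a a'))))
    (cF : ℝ) (hcF : 0 ≤ cF)
    (hQ80 : ∀ j (β' : ℝ) (U : CfgY 𝔸 (f j).toKIdx) (a : AfldY 𝔸 (f j).toKIdx), 0 < β' → C37 j β' U a → ∀ δ : ℝ, 0 < δ → δ ≤ 1 →
      HasMajorant (g := toB6 (geo9Y (f j)) 0 True) (fun q : (Fin (d + 1) × SiteY (f j).toKIdx) × ι => blkC (f j).toKIdx (ιB j) q.1.2)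
          (F₂QC (f j).toKIdx (𝔮 j) b (.base U) (.mult a)) (fun a₁ a₂ => cF * β' * Real.exp (-(δ * (geo9Y (f j)).dist a₁ a₂))) ∧
        HasMajorant (g := toB6 (geo9Y (f j)) 0 True) (fun q : (Fin (d + 1) × SiteY (f j).toKIdx) × ι => blkC (f j).toKIdx (ιB j) q.1.2)
          (F₂sQC (f j).toKIdx (𝔮s j) b (.base U) (.mult a)) (fun a₁ a₂ => cF * β' * Real.exp (-(δ * (geo9Y (f j)).dist a₁ a₂))))
    (hMd : 2 * ((d : ℝ) + 1) < MInv) (mN : ℕ) (hnbr : ∀ (j : J) (y' : IBondY (f j).toKIdx), (nbr (geo9Y (f j)) (2 * ((d : ℝ) + 1)) y').card ≤ mN) :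
    E4H2GFrame₆ c35 (fun j => geo9Y (f j)) (fun j => (codingYx P G (f j) (C37 j) (C38 j)).bg) (fun j => KSC P G (f j) (par j) (C37 j) (C38 j)) b (Fin (d + 1))
      (fun j => SiteY (f j).toKIdx) (fun j => BlkY (f j).toKIdx × ι)
      (fun j => KACU P G (f j) (GAQY (f j).toKIdx (𝔮 j) (𝔮s j) (par j) (GpY (f j).toKIdx (par j))) (parB j) (C37 j) (C38 j))
      (fun j => pullS (codingYx P G (f j) (C37 j) (C38 j)) (CinvY P f G par j)) :=
  { gFrame₅CodedOnSelQ P f c35 G 𝔮 𝔮s par parB b ιB C37 C38 hι hG1 M₂ hM₂ hrepr hcR Cq hCq hC37 MInv aInv aW hMInv haInv haW hparG hparC hunitG hunitXG hsym hunitA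
      hb₁ C₀ hC₀ hreg335P hC37G κQ hκQ hQ15 cF hcF hQ80 hMd mN hnbr with
    wE4G := fun B δc Bε => wE4G6 (2 * ((d : ℝ) + 1)) (∑ j, ‖b j‖) M₂ B δc Bε
    wH2G := fun B δc Bβ Bε Bεβ => wH2G6 (2 * ((d : ℝ) + 1)) (∑ j, ‖b j‖) M₂ B δc Bβ Bε Bεβ
    wHGδ' := fun δc => δc / 7
    wHGδ'_pos := fun δc hδc => by positivity
    e4h2G_transfer := fun j α₀ c c' α₁ B₀ B δ δc Bβ Bε Bεβ hM hα₀ hMa hreg hα₁ haW' h37 hB₀ hB hδ hδc hδcδ hE hHH HV HVI => by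
      obtain ⟨U, a, rfl, rfl, hC⟩ := (codingYx P G (f j) (C37 j) (C38 j)).exists_of_bg_Cplx337 h37
      have hR : InRegY G (f j).toKIdx (par j) U := ⟨(hC37 j α₁ U a hC).1, hparC j α₁ U a hC⟩
      dsimp only [gFrame₅CodedOnSelQ, cinvFrame₃CodedOnSel, gpFrame₂CodedOnSel] at HV HVI
      erw [parSelC_base_of_inRegY G (f j).toKIdx (par j) hR] at HV HVI
      exact e4h2G_transfer_KACUQ P c35 G (f j) (𝔮 j) (𝔮s j) (par j) (parB j) b (ιB j) (C37 j) (C38 j) (hι j) hG1 hM₂ hrepr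
        (fun δ' => M₂ * (∑ j, ‖b j‖) + cXY (d := d) (ℓ := ℓ) b M₂ mN δ') α₀ (.base U) (.mult a) α₁ B₀ B δ δc Bβ Bε Bεβ hM hα₀ hMa hreg hα₁ haW' h37
        hB₀ hB hδ hδc hδcδ (le_add_of_nonneg_right (cXY_nonneg (d := d) (ℓ := ℓ) b hM₂ mN δ)) hE hHH HV HVI }

end E4H2G

end Literature.MathematicalPhysics.QuantumFieldTheory.Balaban1983to89.B9SectBGFramesSelQY

end
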